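import Summits.HodgeConjecture.CorCM.MumfordTateRankSixCenter
import Literature.AlgebraicGeometry.Motives.AbelianVarietyPoincareSplitting
import Literature.AlgebraicGeometry.HodgeTheory.CMTypeOfCommutingRationalAction
import Literature.AlgebraicGeometry.HodgeTheory.AbelianVarietyHodgeFullnessNonVacuity
import Literature.AlgebraicGeometry.HodgeTheory.WeilFamilyReachOfPeriodConstruction
import Literature.AlgebraicGeometry.ComplexMultiplication.EndFieldTotallyRealOrCMOfRiemann
import Literature.AlgebraicGeometry.ComplexMultiplication.ShimuraInflationBettiJunctions
import Literature.AlgebraicGeometry.Milne1999.CMTypeSubquotients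
import HarnessLib

/-!
# The rungs `dim MT(H¹(X)) ≤ 6` of the Mumford–Tate rank ladder for complex abelian varieties NOT of CM type, II:
# the splitting `X ∼ Y × Z` along the central idempotent, and `Z` is of CM type

COR-CM (cell `pub-hodgecm2`, seat `b27` gen 37, count-neutral lane MT-RANK-SIX-ISOGENY; theorems only, no definition,
no named fact; UNCONDITIONAL — nothing here uses or asserts HC_CM).  Sequel of `CorCM/MumfordTateRankSixCenter`.

For a complex abelian variety `X` whose Hodge Lie algebra has a three-dimensional derived algebra (e.g. `X` NOT of CM
type with `dim MT(H¹X) ≤ 6`), let `e ∈ Z(End⁰ X)` be the central idempotent of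
`exists_central_idempotent_of_finrank_derived_eq_three` (Hodge group acting on `e H¹` through `SL₂` and on `(1 − e) H¹` through
its central torus).  Writing `M e = F` with `F ∈ End X` (`endAlgebra.exists_eq_algebraMap_mul_of`), `F² = M F`
(faithfulness of `H¹`, `AbelianVariety.hom_eq_of_bettiCohomology_map_one_eq`), so `F = (X ↠ im F ↪ X)` is a
quasi-retraction and Poincaré's complement (`AbelianVariety.exists_complement_of_quasiRetraction`, Mumford §19) splits
`X ∼ Y × Z` with `Y = im F`, `Z = im (M − F)`:

* `exists_sq_eq_nsmul_of_idempotent` — the integral lift `F` of a (central) idempotent of `End⁰(X)`.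
* **`exists_quasiRetraction_splitting_of_finrank_derived_eq_three`** (any `X` with `0 < dim X` and
  `dim [Lie Hg(H¹X), Lie Hg(H¹X)] = 3`, i.e. Hodge group of semisimple rank one) and its special case
  **`exists_quasiRetraction_splitting_of_mtRank_le_six`** (`X` not CM, `dim MT(H¹X) ≤ 6`) — the splitting `X ∼ Y ⊞ Z` with its structure maps
  `h : X ↠ Y`, `i : Y ↪ X`, `t : X ↠ Z`, `j : Z ↪ X` (`h ≫ i = F`, `i ≫ h = M`, `j ≫ t = M`, `h ≫ i + t ≫ j = M`,
  `i ≫ t = 0`, `j ≫ h = 0`), `F^* = M e^*`, AND **`Z` is of CM type**: an endomorphism `s` of `H¹(Z(ℂ); ℚ)` commuting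
  with the transported centre `j^* z^* t^*` (`z ∈ Z(End⁰ X)`) gives `a = t^* s j^*` killed by `e^*` on both sides and
  commuting with `Z(End⁰ X)^*`, hence `a = w^*` is a Hodge endomorphism (the lever of `MumfordTateRankSixCenter`), and
  `s = M⁻² j^* a t^*` is a morphism of Hodge structures; so `Z` is of CM type by the tree's
  `isOfCMType_of_commutant_isHodgeMorphismOne_of_commute_set` (Deligne I 5.1 / Milne Rem. 1.10), and `Y` is NOT.

The sequel `CorCM/MumfordTateRankSixIsogeny` reads `End⁰(Y)` off the corner `e End⁰(X) e` (`Y ∼ B^{m+1}`).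

## References

* [MoonenZarhin1999LowDim] B. Moonen, Yu. Zarhin, *Hodge classes on abelian varieties of low dimension*, Math. Ann.
  315 (1999), §2.
* [MumfordAV1970] D. Mumford, *Abelian Varieties* (1970), §19 Thm. 1 and proof of Cor. 2 (pp. 173–174).
* [Deligne1982HodgeCycles] P. Deligne, *Hodge cycles on abelian varieties*, LNM 900 (1982), I §5 Prop. 5.1.
* [DeligneMilne1982Tannakian] P. Deligne, J. S. Milne, *Tannakian Categories*, LNM 900 (1982), II Thm. 6.20 (Riemann).
-/

noncomputable section

open scoped TensorProduct
open CategoryTheory CategoryTheory.Limits Module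

namespace Summit.HodgeConjecture.CorCM

open Literature.AlgebraicGeometry.Motives
open Literature.AlgebraicGeometry.Motives.AbelianVariety
open Literature.AlgebraicGeometry.Motives.HodgeStructure
open Literature.AlgebraicGeometry.HodgeTheory
open Literature.AlgebraicGeometry.ComplexMultiplication (bettiRep bettiRep_injective bettiRep_of
  bettiCohomology_map_add_one bettiCohomology_map_nsmul_one bettiCohomology_map_id_hom bettiCohomology_map_comp_hom
  bettiCohomology_map_nsmul_id_one bettiCohomology_map_zero_one isHodgeMorphismOne_of_map_F_le)
open Literature.AlgebraicGeometry.Milne1999 (IsOfCMType isOfCMType_iff_of_isIsogenous isOfCMType_biprod_iff)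
open _root_.AlgebraicGeometry

variable [HodgeTensorFacts.{0, 0}] {X : AbelianVariety ℂ} {n : ℕ}

/-! ## §1 The integral lift of an idempotent of `End⁰(X)` -/

omit [HodgeTensorFacts.{0, 0}] in
/-- **Integral lift of an idempotent**: for `e ∈ End⁰(X)` with `e² = e` there are `M ≥ 1` and `F ∈ End X` with
`F = M e` in `End⁰(X)`, `F^* = M · e^*` on `H¹(X(ℂ); ℚ)`, and `F ≫ F = M • F` (clear denominators,
`endAlgebra.exists_eq_algebraMap_mul_of`; the last identity by faithfulness of `H¹`,
`AbelianVariety.hom_eq_of_bettiCohomology_map_one_eq`). [cite: MumfordAV1970, §19 Thm. 3] -/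
theorem exists_sq_eq_nsmul_of_idempotent (e : X.endAlgebra) (hee : e * e = e) :
    ∃ (M : ℕ) (F : X ⟶ X), M ≠ 0 ∧ AbelianVariety.endAlgebra.of X F = algebraMap ℚ X.endAlgebra (M : ℚ) * e ∧
      (bettiCohomology.map F.hom.hom.hom 1).hom = (M : ℚ) • MulOpposite.unop (bettiRep X e) ∧
      F ≫ F = M • F := by
  obtain ⟨M, F, hM, he⟩ := AbelianVariety.endAlgebra.exists_eq_algebraMap_mul_of e
  have hM' : (M : ℚ) ≠ 0 := Nat.cast_ne_zero.mpr hM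
  have hF : AbelianVariety.endAlgebra.of X F = algebraMap ℚ X.endAlgebra (M : ℚ) * e := by
    rw [he, ← mul_assoc, ← map_mul, mul_inv_cancel₀ hM', map_one, one_mul]
  have hFe : (bettiCohomology.map F.hom.hom.hom 1).hom = (M : ℚ) • MulOpposite.unop (bettiRep X e) := by
    have h := bettiRep_of (A := X) F
    rw [hF, map_mul, AlgHom.commutes, Algebra.algebraMap_eq_smul_one, smul_mul_assoc, one_mul] at h
    have h' := congrArg MulOpposite.unop h
    rw [MulOpposite.unop_smul, MulOpposite.unop_op] at h'
    exact h'.symm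
  refine ⟨M, F, hM, hF, hFe, ?_⟩
  -- `F ≫ F = M • F` by faithfulness of `H¹`
  apply AbelianVariety.hom_eq_of_bettiCohomology_map_one_eq
  apply ModuleCat.hom_ext
  have hpp : MulOpposite.unop (bettiRep X e) * MulOpposite.unop (bettiRep X e) = MulOpposite.unop (bettiRep X e) := by
    rw [← MulOpposite.unop_mul, ← map_mul, hee]
  rw [bettiCohomology_map_comp_hom, ModuleCat.hom_comp, bettiCohomology_map_nsmul_one, ModuleCat.hom_nsmul, hFe,
    ← Nat.cast_smul_eq_nsmul ℚ]
  refine LinearMap.ext fun x => ?_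
  rw [LinearMap.comp_apply, LinearMap.smul_apply, LinearMap.smul_apply, map_smul, LinearMap.smul_apply,
    LinearMap.smul_apply, ← Module.End.mul_apply, hpp]

/-! ## §2 The splitting `X ∼ Y ⊞ Z` and `Z` is of CM type -/

/-- **The splitting of an abelian variety with `dim [Lie Hg(H¹X), Lie Hg(H¹X)] = 3` along its central idempotent, and
the complementary part is of CM type** (see the module docstring).  Output: the idempotent `e` of
`exists_central_idempotent_of_finrank_derived_eq_three` with all its properties, `M ≥ 1`, `F ∈ End X` with `F^* = M e^*`,
`F ≫ F = M F`, and abelian varieties `Y, Z` with `h : X ⟶ Y`, `i : Y ⟶ X`, `t : X ⟶ Z`, `j : Z ⟶ X` such that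
`h ≫ i = F`, `i ≫ h = M`, `j ≫ t = M`, `i ≫ t = 0`, `j ≫ h = 0`, `h ≫ i + t ≫ j = M`, `biprod.desc i j : Y ⊞ Z ⟶ X` an
isogeny, `dim Y + dim Z = dim X`, `Z` of CM type and `Y` not of CM type.
[cite: MumfordAV1970, §19 Thm. 1 and proof of Cor. 2 (pp. 173–174)] [cite: MoonenZarhin1999LowDim, §2]
[cite: Deligne1982HodgeCycles, I §5 Prop. 5.1] [cite: DeligneMilne1982Tannakian, II §6 Thm. 6.20] -/
theorem exists_quasiRetraction_splitting_of_finrank_derived_eq_three (hX : IsSmoothProjective n X.X) (h0 : 0 < X.dim)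
    (h3 : haveI := BettiUniverse.finite hX 1
      Module.finrank ℚ ↥(Submodule.span ℚ {B | ∃ X' ∈ (BettiUniverse.hodge exists_isReal_hodgeModel_holds hX 1).hodgeLie,
        ∃ Y ∈ (BettiUniverse.hodge exists_isReal_hodgeModel_holds hX 1).hodgeLie, X' * Y - Y * X' = B}) = 3) :
    haveI := BettiUniverse.finite hX 1
    ∃ (e : X.endAlgebra) (M : ℕ) (F : X ⟶ X) (Y Z : AbelianVariety ℂ) (h : X ⟶ Y) (i : Y ⟶ X) (t : X ⟶ Z)
      (j : Z ⟶ X),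
      e ∈ Subalgebra.center ℚ X.endAlgebra ∧ e * e = e ∧ e ≠ 0 ∧
      (e = 1 ↔ (BettiUniverse.hodge exists_isReal_hodgeModel_holds hX 1).mtRank = 4) ∧ M ≠ 0 ∧
      AbelianVariety.endAlgebra.of X F = algebraMap ℚ X.endAlgebra (M : ℚ) * e ∧
      (bettiCohomology.map F.hom.hom.hom 1).hom = (M : ℚ) • MulOpposite.unop (bettiRep X e) ∧
      h ≫ i = F ∧ i ≫ h = M • 𝟙 Y ∧ j ≫ t = M • 𝟙 Z ∧ i ≫ t = 0 ∧ j ≫ h = 0 ∧ h ≫ i + t ≫ j = M • 𝟙 X ∧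
      IsIsogeny (biprod.desc i j) ∧ Y.dim + Z.dim = X.dim ∧ IsOfCMType Z ∧ ¬ IsOfCMType Y ∧
      (∀ K : Submodule ℚ X.endAlgebra, (∀ w, w ∈ K ↔ e * w = w) →
        4 * Module.finrank ℚ K = Module.finrank ℚ (LinearMap.range (MulOpposite.unop (bettiRep X e))) ^ 2) ∧
      (∀ w : X.endAlgebra, e * w = w → (∀ w' : X.endAlgebra, e * w' = w' → w * w' = w' * w) → ∃ c : ℚ, w = c • e) ∧
      Module.finrank ℚ (LinearMap.range (MulOpposite.unop (bettiRep X e))) +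
          Module.finrank ℚ (LinearMap.ker (MulOpposite.unop (bettiRep X e))) = 2 * X.dim ∧
      0 < Module.finrank ℚ (LinearMap.range (MulOpposite.unop (bettiRep X e))) ∧
      (bettiCohomology.map i.hom.hom.hom 1).hom ∘ₗ (bettiCohomology.map h.hom.hom.hom 1).hom =
        (M : ℚ) • LinearMap.id ∧
      (bettiCohomology.map h.hom.hom.hom 1).hom ∘ₗ (bettiCohomology.map i.hom.hom.hom 1).hom =
        (M : ℚ) • MulOpposite.unop (bettiRep X e) ∧
      (bettiCohomology.map j.hom.hom.hom 1).hom ∘ₗ (bettiCohomology.map t.hom.hom.hom 1).hom =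
        (M : ℚ) • LinearMap.id ∧
      (bettiCohomology.map t.hom.hom.hom 1).hom ∘ₗ (bettiCohomology.map j.hom.hom.hom 1).hom =
        (M : ℚ) • LinearMap.id - (M : ℚ) • MulOpposite.unop (bettiRep X e) ∧
      (∀ X' ∈ (BettiUniverse.hodge exists_isReal_hodgeModel_holds hX 1).hodgeLie,
        X' - MulOpposite.unop (bettiRep X e) * X' ∈ (BettiUniverse.hodge exists_isReal_hodgeModel_holds hX 1).hodgeLie) ∧
      (∀ Z' ∈ (BettiUniverse.hodge exists_isReal_hodgeModel_holds hX 1).hodgeLie ⊓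
          Subalgebra.toSubmodule (BettiUniverse.hodge exists_isReal_hodgeModel_holds hX 1).endAlg,
        Z' * MulOpposite.unop (bettiRep X e) = 0) := by
  have hcm : ¬ IsOfCMType X := not_isOfCMType_of_finrank_derived_eq_three hX h3
  have hn : X.dim = n := schemeDim_eq_holds hX
  subst hn
  haveI := BettiUniverse.finite hX 1
  obtain ⟨e, hec, hee, he0, he1, x, y, hxy, hx0, hxdef, hydef, hdim, hcen, hlever, hblk, hZe⟩ :=
    exists_central_idempotent_of_finrank_derived_eq_three hX h0 h3
  subst hxdef
  subst hydef
  obtain ⟨M, F, hM, hFe, hFrep, hFF⟩ := exists_sq_eq_nsmul_of_idempotent e hee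
  have hM' : (M : ℚ) ≠ 0 := Nat.cast_ne_zero.mpr hM
  -- notation for the rational representation
  set V := bettiCohomology X.X 1 with hV
  set p : Module.End ℚ V := MulOpposite.unop (bettiRep X e) with hpdef
  have hρmul : ∀ w w' : X.endAlgebra,
      MulOpposite.unop (bettiRep X (w * w')) = MulOpposite.unop (bettiRep X w') * MulOpposite.unop (bettiRep X w) :=
    fun w w' => by rw [map_mul, MulOpposite.unop_mul]
  have hpz : ∀ z : X.endAlgebra, p * MulOpposite.unop (bettiRep X z) = MulOpposite.unop (bettiRep X z) * p := by
    intro z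
    rw [hpdef, ← hρmul, ← hρmul, Subalgebra.mem_center_iff.1 hec z]
  have hpp : p * p = p := by rw [hpdef, ← hρmul, hee]
  -- pull-back bookkeeping on `H¹`
  have hcomp : ∀ {A B C : AbelianVariety ℂ} (f : A ⟶ B) (g : B ⟶ C),
      (bettiCohomology.map (f ≫ g).hom.hom.hom 1).hom =
        (bettiCohomology.map f.hom.hom.hom 1).hom ∘ₗ (bettiCohomology.map g.hom.hom.hom 1).hom := by
    intro A B C f g
    rw [bettiCohomology_map_comp_hom, ModuleCat.hom_comp]
  have hnsid : ∀ (A : AbelianVariety ℂ) (N : ℕ),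
      (bettiCohomology.map (N • 𝟙 A : A ⟶ A).hom.hom.hom 1).hom = (N : ℚ) • (1 : Module.End ℚ _) := by
    intro A N
    rw [bettiCohomology_map_nsmul_id_one, ModuleCat.hom_nsmul, ModuleCat.hom_id, Nat.cast_smul_eq_nsmul,
      Module.End.one_eq_id]
  have hzero : ∀ (A B : AbelianVariety ℂ), (bettiCohomology.map (0 : A ⟶ B).hom.hom.hom 1).hom = 0 := by
    intro A B
    rw [bettiCohomology_map_zero_one, ModuleCat.hom_zero]
  -- the quasi-retraction `F = h ≫ i`, `i ≫ h = M`
  set Y := AbelianVariety.image F with hY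
  set i : Y ⟶ X := AbelianVariety.imageι F with hidef
  set h : X ⟶ Y := AbelianVariety.toImage F with hhdef
  have hhi : h ≫ i = F := AbelianVariety.toImage_imageι F
  have hih : i ≫ h = M • 𝟙 Y := by
    haveI := AbelianVariety.mono_of_isClosedImmersion_toSchemeHom (AbelianVariety.imageι F)
    haveI := AbelianVariety.epi_of_surjective_toSchemeHom (AbelianVariety.toImage F)
    rw [← cancel_mono (AbelianVariety.imageι F), ← cancel_epi (AbelianVariety.toImage F)]
    change h ≫ (i ≫ h) ≫ i = h ≫ (M • 𝟙 Y) ≫ i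
    calc h ≫ (i ≫ h) ≫ i = (h ≫ i) ≫ (h ≫ i) := by simp only [Category.assoc]
      _ = F ≫ F := by rw [hhi]
      _ = M • F := hFF
      _ = h ≫ (M • 𝟙 Y) ≫ i := by rw [Preadditive.nsmul_comp, Category.id_comp, Preadditive.comp_nsmul, hhi]
  obtain ⟨Z, j, t, -, hiso, hjh, hdimYZ, hld, hdl⟩ := AbelianVariety.exists_complement_of_quasiRetraction i h hM hih
  have hsum : h ≫ i + t ≫ j = M • 𝟙 X := by rw [← biprod.lift_desc]; exact hld
  have hit : i ≫ t = 0 := by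
    have h' := congrArg (fun f => biprod.inl ≫ f ≫ biprod.snd) hdl
    simpa only [biprod.inl_desc_assoc, Category.assoc, biprod.lift_snd, Preadditive.comp_nsmul, Category.comp_id,
      Category.id_comp, Preadditive.nsmul_comp, biprod.inl_snd, smul_zero] using h'
  have hjt : j ≫ t = M • 𝟙 Z := by
    have h' := congrArg (fun f => biprod.inr ≫ f ≫ biprod.snd) hdl
    simpa only [biprod.inr_desc_assoc, Category.assoc, biprod.lift_snd, Preadditive.comp_nsmul, Category.comp_id,
      Category.id_comp, Preadditive.nsmul_comp, biprod.inr_snd] using h'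
  -- the pull-backs
  set iS := (bettiCohomology.map i.hom.hom.hom 1).hom with hiS
  set hS := (bettiCohomology.map h.hom.hom.hom 1).hom with hhS
  set jS := (bettiCohomology.map j.hom.hom.hom 1).hom with hjS
  set tS := (bettiCohomology.map t.hom.hom.hom 1).hom with htS
  have h1 : iS ∘ₗ hS = (M : ℚ) • (1 : Module.End ℚ _) := by rw [hiS, hhS, ← hcomp, hih, hnsid]
  have h2 : hS ∘ₗ iS = (M : ℚ) • p := by rw [hhS, hiS, ← hcomp, hhi, hFrep]
  have h3 : jS ∘ₗ tS = (M : ℚ) • (1 : Module.End ℚ _) := by rw [hjS, htS, ← hcomp, hjt, hnsid]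
  have h5 : iS ∘ₗ tS = 0 := by rw [hiS, htS, ← hcomp, hit, hzero]
  have h6 : jS ∘ₗ hS = 0 := by rw [hjS, hhS, ← hcomp, hjh, hzero]
  have h4 : tS ∘ₗ jS = (M : ℚ) • (1 : Module.End ℚ _) - (M : ℚ) • p := by
    have h' : (bettiCohomology.map (h ≫ i + t ≫ j).hom.hom.hom 1).hom = (M : ℚ) • (1 : Module.End ℚ _) := by
      rw [hsum, hnsid]
    rw [bettiCohomology_map_add_one, ModuleCat.hom_add, hcomp, hcomp, ← hhS, ← hiS, ← htS, ← hjS, h2] at h'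
    rw [← h']
    abel
  -- `t^* j^*` commutes with the centre
  have h4z : ∀ z : X.endAlgebra, z ∈ Subalgebra.center ℚ X.endAlgebra →
      (tS ∘ₗ jS) * MulOpposite.unop (bettiRep X z) = MulOpposite.unop (bettiRep X z) * (tS ∘ₗ jS) := by
    intro z _
    rw [h4, sub_mul, mul_sub, smul_mul_assoc, smul_mul_assoc, mul_smul_comm, mul_smul_comm, one_mul, mul_one, hpz z]
  -- the transported centre on `H¹(Z)` and its commutativity
  set S : Set (Module.End ℚ (bettiCohomology Z.X 1)) :=
    Set.range (fun z : Subalgebra.center ℚ X.endAlgebra => jS ∘ₗ MulOpposite.unop (bettiRep X (z : X.endAlgebra)) ∘ₗ tS)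
    with hSdef
  have hkeyL : ∀ z : X.endAlgebra, z ∈ Subalgebra.center ℚ X.endAlgebra →
      (jS ∘ₗ MulOpposite.unop (bettiRep X z) ∘ₗ tS) ∘ₗ jS = (M : ℚ) • (jS ∘ₗ MulOpposite.unop (bettiRep X z)) := by
    intro z hz
    calc (jS ∘ₗ MulOpposite.unop (bettiRep X z) ∘ₗ tS) ∘ₗ jS
        = jS ∘ₗ (MulOpposite.unop (bettiRep X z) * (tS ∘ₗ jS)) := by rfl
      _ = jS ∘ₗ ((tS ∘ₗ jS) * MulOpposite.unop (bettiRep X z)) := by rw [h4z z hz]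
      _ = (jS ∘ₗ tS) ∘ₗ (jS ∘ₗ MulOpposite.unop (bettiRep X z)) := by rfl
      _ = (M : ℚ) • (jS ∘ₗ MulOpposite.unop (bettiRep X z)) := by
          rw [h3, LinearMap.smul_comp, Module.End.one_eq_id, LinearMap.id_comp]
  have hkeyR : ∀ z : X.endAlgebra, z ∈ Subalgebra.center ℚ X.endAlgebra →
      tS ∘ₗ (jS ∘ₗ MulOpposite.unop (bettiRep X z) ∘ₗ tS) = (M : ℚ) • (MulOpposite.unop (bettiRep X z) ∘ₗ tS) := by
    intro z hz
    calc tS ∘ₗ (jS ∘ₗ MulOpposite.unop (bettiRep X z) ∘ₗ tS)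
        = ((tS ∘ₗ jS) * MulOpposite.unop (bettiRep X z)) ∘ₗ tS := by rfl
      _ = (MulOpposite.unop (bettiRep X z) * (tS ∘ₗ jS)) ∘ₗ tS := by rw [h4z z hz]
      _ = (MulOpposite.unop (bettiRep X z) ∘ₗ tS) ∘ₗ (jS ∘ₗ tS) := by rfl
      _ = (M : ℚ) • (MulOpposite.unop (bettiRep X z) ∘ₗ tS) := by
          rw [h3, LinearMap.comp_smul, Module.End.one_eq_id, LinearMap.comp_id]
  have hScomm : ∀ s ∈ S, ∀ s' ∈ S, s * s' = s' * s := by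
    rintro _ ⟨⟨z, hz⟩, rfl⟩ _ ⟨⟨z', hz'⟩, rfl⟩
    change (jS ∘ₗ MulOpposite.unop (bettiRep X z) ∘ₗ tS) ∘ₗ (jS ∘ₗ MulOpposite.unop (bettiRep X z') ∘ₗ tS) =
      (jS ∘ₗ MulOpposite.unop (bettiRep X z') ∘ₗ tS) ∘ₗ (jS ∘ₗ MulOpposite.unop (bettiRep X z) ∘ₗ tS)
    have hzz : MulOpposite.unop (bettiRep X z) * MulOpposite.unop (bettiRep X z') =
        MulOpposite.unop (bettiRep X z') * MulOpposite.unop (bettiRep X z) := by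
      rw [← hρmul, ← hρmul, Subalgebra.mem_center_iff.1 hz z']
    calc (jS ∘ₗ MulOpposite.unop (bettiRep X z) ∘ₗ tS) ∘ₗ (jS ∘ₗ MulOpposite.unop (bettiRep X z') ∘ₗ tS)
        = ((jS ∘ₗ MulOpposite.unop (bettiRep X z) ∘ₗ tS) ∘ₗ jS) ∘ₗ MulOpposite.unop (bettiRep X z') ∘ₗ tS := by rfl
      _ = ((M : ℚ) • (jS ∘ₗ MulOpposite.unop (bettiRep X z))) ∘ₗ MulOpposite.unop (bettiRep X z') ∘ₗ tS := by
          rw [hkeyL z hz]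
      _ = (M : ℚ) • (jS ∘ₗ (MulOpposite.unop (bettiRep X z) * MulOpposite.unop (bettiRep X z')) ∘ₗ tS) := by
          rw [LinearMap.smul_comp]; rfl
      _ = (M : ℚ) • (jS ∘ₗ (MulOpposite.unop (bettiRep X z') * MulOpposite.unop (bettiRep X z)) ∘ₗ tS) := by rw [hzz]
      _ = ((M : ℚ) • (jS ∘ₗ MulOpposite.unop (bettiRep X z'))) ∘ₗ MulOpposite.unop (bettiRep X z) ∘ₗ tS := by
          rw [LinearMap.smul_comp]; rfl
      _ = ((jS ∘ₗ MulOpposite.unop (bettiRep X z') ∘ₗ tS) ∘ₗ jS) ∘ₗ MulOpposite.unop (bettiRep X z) ∘ₗ tS := by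
          rw [hkeyL z' hz']
      _ = (jS ∘ₗ MulOpposite.unop (bettiRep X z') ∘ₗ tS) ∘ₗ (jS ∘ₗ MulOpposite.unop (bettiRep X z) ∘ₗ tS) := by rfl
  -- the lever: endomorphisms of `H¹(Z)` commuting with `S` are morphisms of Hodge structures
  have hlev : ∀ s : Module.End ℚ (bettiCohomology Z.X 1), (∀ s' ∈ S, s' * s = s * s') → IsHodgeMorphismOne Z Z s := by
    intro s hs
    set a : Module.End ℚ V := tS ∘ₗ s ∘ₗ jS with hadef
    have hap : a * p = 0 := by
      have h' : a ∘ₗ (hS ∘ₗ iS) = 0 := by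
        change tS ∘ₗ s ∘ₗ ((jS ∘ₗ hS) ∘ₗ iS) = 0
        rw [h6, LinearMap.zero_comp, LinearMap.comp_zero, LinearMap.comp_zero]
      rw [h2, LinearMap.comp_smul] at h'
      exact (smul_eq_zero.1 h').resolve_left hM'
    have hpa : p * a = 0 := by
      have h' : (hS ∘ₗ iS) ∘ₗ a = 0 := by
        change hS ∘ₗ ((iS ∘ₗ tS) ∘ₗ s ∘ₗ jS) = 0
        rw [h5, LinearMap.zero_comp, LinearMap.comp_zero]
      rw [h2, LinearMap.smul_comp] at h'
      exact (smul_eq_zero.1 h').resolve_left hM'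
    have haz : ∀ z ∈ Subalgebra.center ℚ X.endAlgebra,
        a * MulOpposite.unop (bettiRep X z) = MulOpposite.unop (bettiRep X z) * a := by
      intro z hz
      have hsz : (jS ∘ₗ MulOpposite.unop (bettiRep X z) ∘ₗ tS) * s = s * (jS ∘ₗ MulOpposite.unop (bettiRep X z) ∘ₗ tS) :=
        hs _ ⟨⟨z, hz⟩, rfl⟩
      have hl : (M : ℚ) • (a * MulOpposite.unop (bettiRep X z)) =
          tS ∘ₗ (s * (jS ∘ₗ MulOpposite.unop (bettiRep X z) ∘ₗ tS)) ∘ₗ jS := by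
        calc (M : ℚ) • (a * MulOpposite.unop (bettiRep X z))
            = tS ∘ₗ s ∘ₗ ((M : ℚ) • (jS ∘ₗ MulOpposite.unop (bettiRep X z))) := by
              rw [LinearMap.comp_smul, LinearMap.comp_smul]; rfl
          _ = tS ∘ₗ s ∘ₗ ((jS ∘ₗ MulOpposite.unop (bettiRep X z) ∘ₗ tS) ∘ₗ jS) := by rw [hkeyL z hz]
          _ = tS ∘ₗ (s * (jS ∘ₗ MulOpposite.unop (bettiRep X z) ∘ₗ tS)) ∘ₗ jS := by rfl
      have hr : (M : ℚ) • (MulOpposite.unop (bettiRep X z) * a) =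
          tS ∘ₗ ((jS ∘ₗ MulOpposite.unop (bettiRep X z) ∘ₗ tS) * s) ∘ₗ jS := by
        calc (M : ℚ) • (MulOpposite.unop (bettiRep X z) * a)
            = ((M : ℚ) • (MulOpposite.unop (bettiRep X z) ∘ₗ tS)) ∘ₗ s ∘ₗ jS := by
              rw [LinearMap.smul_comp]; rfl
          _ = (tS ∘ₗ (jS ∘ₗ MulOpposite.unop (bettiRep X z) ∘ₗ tS)) ∘ₗ s ∘ₗ jS := by rw [hkeyR z hz]
          _ = tS ∘ₗ ((jS ∘ₗ MulOpposite.unop (bettiRep X z) ∘ₗ tS) * s) ∘ₗ jS := by rfl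
      rw [hsz] at hr
      exact smul_right_injective _ hM' (hl.trans hr.symm)
    obtain ⟨w, hw⟩ := hlever a hap hpa haz
    -- `a` is a Hodge endomorphism of `H¹(X)`
    have haA : a ∈ (BettiUniverse.hodge exists_isReal_hodgeModel_holds hX 1).endAlg := by
      rw [← hw]
      exact Literature.AlgebraicGeometry.ComplexMultiplication.unop_bettiRep_mem_endAlg exists_isReal_hodgeModel_holds
        hodgePQ_independent_of_hodgeModel_holds w
    have haH : IsHodgeMorphismOne X X a :=
      isHodgeMorphismOne_of_map_F_le exists_isReal_hodgeModel_holds hodgePQ_independent_of_hodgeModel_holds a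
        ((mem_endAlg_iff _ a).1 haA)
    -- `s = M⁻² j^* a t^*`
    have hsa : s = ((M : ℚ)⁻¹ * (M : ℚ)⁻¹) • (jS ∘ₗ (a ∘ₗ tS)) := by
      have h' : jS ∘ₗ (a ∘ₗ tS) = ((M : ℚ) * (M : ℚ)) • s := by
        change (jS ∘ₗ tS) ∘ₗ s ∘ₗ (jS ∘ₗ tS) = _
        rw [h3, LinearMap.smul_comp, LinearMap.comp_smul, Module.End.one_eq_id, LinearMap.id_comp, LinearMap.comp_id,
          smul_smul]
      rw [h', smul_smul, mul_assoc, ← mul_assoc (M : ℚ)⁻¹ (M : ℚ), inv_mul_cancel₀ hM', one_mul, inv_mul_cancel₀ hM',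
        one_smul]
    rw [hsa]
    exact isHodgeMorphismOne_ratSmul (isHodgeMorphismOne_comp (isHodgeMorphismOne_map j)
      (isHodgeMorphismOne_comp haH (isHodgeMorphismOne_map t))) _
  have hZcm : IsOfCMType Z := isOfCMType_of_commutant_isHodgeMorphismOne_of_commute_set S hScomm hlev
  -- `Y` is not of CM type
  have hYcm : ¬ IsOfCMType Y := by
    intro hY'
    have hYZ : IsOfCMType (Y ⊞ Z) := isOfCMType_biprod_iff.2 ⟨hY', hZcm⟩
    exact hcm ((isOfCMType_iff_of_isIsogenous ⟨biprod.desc i j, hiso⟩).1 hYZ)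
  refine ⟨e, M, F, Y, Z, h, i, t, j, hec, hee, he0, he1, hM, hFe, hFrep, hhi, hih, hjt, hit, hjh, hsum, hiso, hdimYZ,
    hZcm, hYcm, hdim, hcen, hxy, hx0, ?_, h2, ?_, ?_, hblk, hZe⟩
  · rw [← Module.End.one_eq_id]
    exact h1
  · rw [← Module.End.one_eq_id]
    exact h3
  · rw [← Module.End.one_eq_id]
    exact h4

/-- **The same splitting for `X` NOT of CM type with `dim MT(H¹X) ≤ 6`** (then `dim [Lie Hg, Lie Hg] = 3`,
`finrank_derived_eq_three_of_mtRank_le_six`). [cite: MumfordAV1970, §19 Thm. 1 and proof of Cor. 2 (pp. 173–174)]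
[cite: MoonenZarhin1999LowDim, §2] -/
theorem exists_quasiRetraction_splitting_of_mtRank_le_six (hX : IsSmoothProjective n X.X) (h0 : 0 < X.dim)
    (hcm : ¬ IsOfCMType X)
    (h6 : haveI := BettiUniverse.finite hX 1
      (BettiUniverse.hodge exists_isReal_hodgeModel_holds hX 1).mtRank ≤ 6) :
    haveI := BettiUniverse.finite hX 1
    ∃ (e : X.endAlgebra) (M : ℕ) (F : X ⟶ X) (Y Z : AbelianVariety ℂ) (h : X ⟶ Y) (i : Y ⟶ X) (t : X ⟶ Z)
      (j : Z ⟶ X),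
      e ∈ Subalgebra.center ℚ X.endAlgebra ∧ e * e = e ∧ e ≠ 0 ∧
      (e = 1 ↔ (BettiUniverse.hodge exists_isReal_hodgeModel_holds hX 1).mtRank = 4) ∧ M ≠ 0 ∧
      AbelianVariety.endAlgebra.of X F = algebraMap ℚ X.endAlgebra (M : ℚ) * e ∧
      (bettiCohomology.map F.hom.hom.hom 1).hom = (M : ℚ) • MulOpposite.unop (bettiRep X e) ∧
      h ≫ i = F ∧ i ≫ h = M • 𝟙 Y ∧ j ≫ t = M • 𝟙 Z ∧ i ≫ t = 0 ∧ j ≫ h = 0 ∧ h ≫ i + t ≫ j = M • 𝟙 X ∧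
      IsIsogeny (biprod.desc i j) ∧ Y.dim + Z.dim = X.dim ∧ IsOfCMType Z ∧ ¬ IsOfCMType Y ∧
      (∀ K : Submodule ℚ X.endAlgebra, (∀ w, w ∈ K ↔ e * w = w) →
        4 * Module.finrank ℚ K = Module.finrank ℚ (LinearMap.range (MulOpposite.unop (bettiRep X e))) ^ 2) ∧
      (∀ w : X.endAlgebra, e * w = w → (∀ w' : X.endAlgebra, e * w' = w' → w * w' = w' * w) → ∃ c : ℚ, w = c • e) ∧
      Module.finrank ℚ (LinearMap.range (MulOpposite.unop (bettiRep X e))) +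
          Module.finrank ℚ (LinearMap.ker (MulOpposite.unop (bettiRep X e))) = 2 * X.dim ∧
      0 < Module.finrank ℚ (LinearMap.range (MulOpposite.unop (bettiRep X e))) ∧
      (bettiCohomology.map i.hom.hom.hom 1).hom ∘ₗ (bettiCohomology.map h.hom.hom.hom 1).hom =
        (M : ℚ) • LinearMap.id ∧
      (bettiCohomology.map h.hom.hom.hom 1).hom ∘ₗ (bettiCohomology.map i.hom.hom.hom 1).hom =
        (M : ℚ) • MulOpposite.unop (bettiRep X e) ∧
      (bettiCohomology.map j.hom.hom.hom 1).hom ∘ₗ (bettiCohomology.map t.hom.hom.hom 1).hom =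
        (M : ℚ) • LinearMap.id ∧
      (bettiCohomology.map t.hom.hom.hom 1).hom ∘ₗ (bettiCohomology.map j.hom.hom.hom 1).hom =
        (M : ℚ) • LinearMap.id - (M : ℚ) • MulOpposite.unop (bettiRep X e) ∧
      (∀ X' ∈ (BettiUniverse.hodge exists_isReal_hodgeModel_holds hX 1).hodgeLie,
        X' - MulOpposite.unop (bettiRep X e) * X' ∈ (BettiUniverse.hodge exists_isReal_hodgeModel_holds hX 1).hodgeLie) ∧
      (∀ Z' ∈ (BettiUniverse.hodge exists_isReal_hodgeModel_holds hX 1).hodgeLie ⊓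
          Subalgebra.toSubmodule (BettiUniverse.hodge exists_isReal_hodgeModel_holds hX 1).endAlg,
        Z' * MulOpposite.unop (bettiRep X e) = 0) :=
  exists_quasiRetraction_splitting_of_finrank_derived_eq_three hX h0 (finrank_derived_eq_three_of_mtRank_le_six hX h0 hcm h6).1

end Summit.HodgeConjecture.CorCM

end
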